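import Mathlib.Analysis.Calculus.ContDiff.Defs
import Mathlib.Analysis.Normed.Operator.LinearIsometry
import Literature.Geometry.Lorentzian.KerrData
import HarnessLib

/-!
# Interior Kerr gluing on the cylinder `{r = r₀}` inside the black hole (Li–Mei 2020)

J. Li, H. Mei, *A construction of collapsing spacetimes in vacuum*, Comm. Math. Phys. 378 (2020)
1343–1389 = arXiv:2005.01249 [LiMei2020], **Proposition 4.1** (§4, arXiv p. 22; it is the content
of their **Theorem 2.2**, §2.2, arXiv p. 8, applied with `ε = C δ^{1/2}`), vendored as the named
fact `LiMei.interiorKerrGluing` (D-0014), together with the chart-level vocabulary it needs.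

## The printed statement (Prop. 4.1)

Let `H ≅ (t₁, t₂) × S²`, `m₀ > 0` and `r₀ ∈ (0, 2m₀)`. Let `(ḡ_{m₀}, π̄_{m₀})` be the data on `H`
equal to the data induced on the slice `{r = r₀, t ∈ (t₁, t₂)}` of the Schwarzschild metric of
mass `m₀` — inside the black hole this cylinder is SPACELIKE, with
`ḡ_m = (2m/r₀ − 1) dt² + r₀² dΩ²`,
`k̄_m = m r₀⁻² (2m/r₀ − 1)^{1/2} dt² − r₀ (2m/r₀ − 1)^{1/2} dΩ²` (their (4.1); the momentum tensor
`π̄ = k̄ − (tr k̄) ḡ` carries the same information). Suppose a (vacuum) initial data set `(ḡ, π̄)`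
on `H` satisfies `‖(ḡ, π̄) − (ḡ_{m₀}, π̄_{m₀})‖_{C^{k,α}(ḡ_{m₀})} < ε` for a sufficiently large `k`
and `α ∈ (0, 1)`. If `ε` is sufficiently small there is another (vacuum) initial data set `(g̃, π̃)`
on `H` with `(g̃, π̃) = (ḡ, π̄)` near `t = t₁`, `(g̃, π̃) = (ḡ_{m,a⃗}, π̄_{m,a⃗})` near `t = t₂` —
the data induced by the Kerr metric `g_{m,a⃗} = (id × Ω_{a⃗})^* g_{m,|a⃗|}` (spin axis rotated to
`a⃗/|a⃗|` by `Ω_{a⃗} ∈ SO(3)`) on its slice `{r = r₀}` INSIDE THE BLACK HOLE,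
`r₋(m,a) < r₀ < r₊(m,a)` — and `‖(g̃, π̃) − (ḡ, π̄)‖_{C^{k,α}(ḡ_{m₀})} < C ε`; in the proof (p. 22
and the degree argument p. 25) the parameters are found in the box `|m − m₀| + |a⃗| ≤ C₀ ε`.
The mechanism: interpolate with a cutoff `φ(t)`, kill the constraint defect by the
Corvino–Schoen local deformation [CorvinoSchoen2006] modulo the cokernel
`ker DΦ* = span{∂_t, Ω₁, Ω₂, Ω₃}` (the Killing fields of Schwarzschild, all tangent to the
cylinder; Moncrief), and absorb the four remaining numbers by the four Kerr parameters
`(m, a⃗)`: `𝓘(m, a⃗) = (8π(m − m₀), −8π m₀ a⃗) + (ε₀, ε⃗) + O(ε²)`.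

## Transport to the tree (what is stated here)

Literature may not import `Summits` (CONVENTIONS §2), so the chart-level vocabulary of the crux
line that consumes this fact (`Summits/FinalStateConjecture/…/SwallowTheDatumParametricKerrBurial
CollarLine.lean`, §1) is re-declared here with the same bodies.

* The cylinder piece `H` is realised on the ANNULUS `A = {ρ₁ < ‖y‖ < ρ₂} ⊂ E3`, `1 ≤ ρ₁ < ρ₂`,
  through the model map `schwCylMap r₀ 0 : y ↦ (t* = ‖y‖, x⃗ = r₀ y/‖y‖)` into the ingoing
  Kerr–Schild chart `Kerr.region 0 r₁` of Schwarzschild(`M`), `M = m₀` (`KerrSchild.lean`). On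
  `{r = r₀}` the Kerr–Schild time is `t* = v − r₀ = t + const` (Boyer–Lindquist/Schwarzschild
  `t`), so their `(t, ϑ) ∈ (t₁, t₂) × S²` is our `(‖y‖ − const, y/‖y‖)`; the constant is
  immaterial (`∂_{t*}` is Killing and tangent to the cylinder) and is carried by the shift `τ₀`
  of the output map.
* ORIENTATIONS. Their `u̲, u` increase to the future and `r` decreases to the future inside the
  hole; the tree's time orientation `Kerr.timeOrientation = −g♯dt*` has `V(r) = −2H < 0`, the same
  future. Their `k̄_m` above is `+g(∇_X ν, Y)` for the future (`r`-decreasing) unit normal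
  `ν = −(2m/r₀ − 1)^{1/2} ∂_r` — the tree's sign convention (h) `K_ν(v, w) = + g(D_v ν, df w)`
  (`Hypersurface.lean`, `InitialData.lean`). Their inner end `t₁` (where output = input) is the
  end of SMALLER advanced time `u̲`, i.e. smaller `t*`, i.e. smaller `‖y‖`; the Kerrian end `t₂` is
  the outer one. (Prop. 4.1 is moreover symmetric under `t ↦ t₁ + t₂ − t`: inside the hole `t` is a
  spatial coordinate and `t ↦ −t` is induced by a time-orientation-preserving isometry of the
  Kruskal interior, `(U, V) ↦ (V, U)`, so it preserves `(ḡ_{m₀}, k̄_{m₀})`.)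
* CLOSENESS is sup-`C^k` on `A` of all Cartesian derivatives of order `≤ k` of the component
  differences on unit test vectors (`NearSchwarzschildCylinder`, Mathlib's `iteratedFDeriv`); on the
  relatively compact annulus this dominates their `C^{k−1,α}(ḡ_{m₀})` norm up to a constant
  depending only on the geometry, so the fact quantifies `∃ k` (theirs plus one) and `∃ ε₀`.
* The OUTPUT Kerr cylinder is `kerrCylMap r₀ a τ₀ R : y ↦ (‖y‖ + τ₀, ellipsoidPt r₀ a (R (y/‖y‖)))`
  onto the confocal ellipsoid `{Kerr.radius a = r₀}` of the Kerr–Schild chart of Kerr(`m, a`)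
  (spin along `z`); the linear isometry `R` of `E3` carries their rotation `Ω_{a⃗}` composed with
  the constant Boyer–Lindquist → Kerr–Schild shift of `φ` on `{r = r₀}` (`φ* = φ + const`, and the
  phase `arg(r₀ ± i a)` of `x + iy = (r ± ia) e^{iφ} sin θ`, Visser arXiv:0706.0622 (32)–(35)); the
  shift of `t` is `τ₀`. Exactness of the output is `h = ψ^* g_{m,a}`, `k = K_ν(ψ)` pointwise on an
  outer sub-annulus (`IsKerrCylinderOn`), with `|a| < m`, `r₋(m,a) < r₀ < r₊(m,a)`.
* INPUT/OUTPUT are smooth data on all of `E3` (`InitialDataSet (𝓡 3) E3`), vacuum on `A`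
  (`IsVacuumOn`); the output agrees with the input on a ball `{‖y‖ < σ₁}`, `σ₁ > ρ₁` (their "near
  `t₁`", extended inside by the input itself) and is unconstrained beyond `ρ₂`.

## Specialisation / regularity (each item recorded honestly)

* Special case of the print: data given on all of `E3` rather than on an abstract `H`; sup-`C^k`
  Cartesian closeness instead of `C^{k,α}(ḡ_{m₀})`; the output closeness `< C ε` is NOT stated
  (`-- TODO(general form)` below); only the parameter box `|m − M| + |a| ≤ C ε` is kept.
* Regularity: Li–Mei print finite regularity (`C^{k,α}` in, `C^{k,α}` out), which is all their
  Step 3 consumes. The tree's `InitialDataSet` is `C^∞`, so input AND output are smooth here; for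
  smooth input the same proof gives smooth output when the local deformation is run in the
  exponentially weighted spaces of Chruściel–Delay, Mém. SMF 94 (2003) = arXiv:gr-qc/0301073
  [ChruscielDelay2003], Prop. 5.10 / Cor. 5.11 (smooth data and smooth defect give a smooth
  deformation extending smoothly by zero; used the same way at the end of the proof of their
  Thm. 8.1), which Li–Mei cite as [C-D] for the deformation step. This is the only point where the
  statement below exceeds the letter of Prop. 4.1.
* NOT stated: Theorem 2.2 itself (it needs the short-pulse spacetime of their Thm. 2.1); the
  equivariant refinement under a finite symmetry group (unprinted; wanted by the crux line, which
  records it separately); anything about developments.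
-/

noncomputable section

open Bundle Set TopologicalSpace
open scoped Manifold ContDiff Topology

namespace Literature.Geometry.Lorentzian

namespace LiMei

/-! ### Vacuum constraints on a subset -/

/-- The datum `D` on `E3` satisfies the VACUUM CONSTRAINT EQUATIONS ON THE SUBSET `s`:
`R(h) − |k|² + (tr k)² = 0` and `div k − d(tr k) = 0` at every point of `s` (the localisation of
`InitialDataSet.IsVacuumConstraintSolution`, with the same standing Levi-Civita binder; both
equations are insensitive to the sign convention for `k`). Choquet-Bruhat 2009, Ch. VI, Thm. 3.3;
Bartnik–Isenberg 2004, (2.1)–(2.2). [folklore] -/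
def IsVacuumOn (s : Set E3) (D : InitialDataSet (𝓡 3) E3) : Prop :=
  ∀ [D.metric.HasLeviCivita], ∀ y ∈ s,
    D.hamiltonianConstraintFn y = 0 ∧ D.momentumConstraintFn y = 0

/-! ### The model cylinders of the Kerr–Schild chart -/

/-- The MODEL SCHWARZSCHILD CYLINDER MAP `y ↦ (t* = ‖y‖ + τ₀, x⃗ = r₀ y/‖y‖)`, `E3 → E4`: it maps
the annulus `{ρ₁ < ‖y‖ < ρ₂}` diffeomorphically onto the piece `t* ∈ (ρ₁ + τ₀, ρ₂ + τ₀)` of the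
cylinder `{r = r₀}` (`r = ‖x⃗‖` for `a = 0`) of the ingoing Kerr–Schild chart of Schwarzschild; for
`0 < r₀ < 2M` that cylinder is a spacelike, homogeneous hypersurface inside the black hole, with
induced data `ḡ_m = (2m/r₀ − 1) dt² + r₀² dΩ²`, `k̄_m` as in the module docstring (Li–Mei
arXiv:2005.01249, (4.1); `t* = t + const` on `{r = r₀}`). Junk value at `y = 0`:
`(τ₀, 0)` (never used: all statements live on `{1 < ‖y‖}`). [folklore] -/
def schwCylMap (r₀ τ₀ : ℝ) (y : E3) : E4 :=
  E4.ofTimeSpace (‖y‖ + τ₀) ((r₀ / ‖y‖) • y)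

/-- The confocal ellipsoid `{Kerr.radius a = r₀}` of the Kerr–Schild chart, parametrised by the
unit sphere: `n ↦ (√(r₀² + a²) n₀, √(r₀² + a²) n₁, r₀ n₂)` (from `x + iy = (r ± ia) e^{iφ} sin θ`,
`z = r cos θ`: Visser arXiv:0706.0622, (32)–(35); `(x² + y²)/(r₀² + a²) + z²/r₀² = 1`).
[cite: arXiv07060622, (32)–(35)] -/
def ellipsoidPt (r₀ a : ℝ) (n : E3) : E3 :=
  WithLp.toLp 2 ![Real.sqrt (r₀ ^ 2 + a ^ 2) * n 0, Real.sqrt (r₀ ^ 2 + a ^ 2) * n 1, r₀ * n 2]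

/-- The STANDARD KERR CYLINDER MAP `y ↦ (t* = ‖y‖ + τ₀, ellipsoidPt r₀ a (R (y/‖y‖)))`, `E3 → E4`,
onto the cylinder `{Kerr.radius a = r₀}` of the ingoing Kerr–Schild chart of Kerr(`m, a`) (spin
along the `z`-axis). The linear isometry `R` of `E3` carries Li–Mei's rotation `Ω_{a⃗}` of the spin
axis (arXiv:2005.01249, §4, p. 22: `g_{m,a⃗} = (id × Ω_{a⃗})^* g_{m,a}`) composed with the constant
Boyer–Lindquist → Kerr–Schild shift of `φ` on `{r = r₀}`; `τ₀` carries the constant shift of `t`.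
For `a = 0`, `R = 1` it is `schwCylMap r₀ τ₀` on `{y ≠ 0}`. Junk value at `y = 0`: `(τ₀, 0)`.
[folklore] -/
def kerrCylMap (r₀ a τ₀ : ℝ) (R : E3 →ₗᵢ[ℝ] E3) (y : E3) : E4 :=
  E4.ofTimeSpace (‖y‖ + τ₀) (ellipsoidPt r₀ a (R (‖y‖⁻¹ • y)))

/-! ### Closeness to the Schwarzschild cylinder; exact Kerr-cylinder data -/

open scoped Classical in
/-- **Near-Schwarzschild-cylinder data** (the HYPOTHESIS of Li–Mei Prop. 4.1, transported): on the
annulus `{ρ₁ < ‖y‖ < ρ₂}` the datum `D` on `E3` is `ε`-close in sup-`C^k` — every Cartesian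
derivative of order `i ≤ k` (Mathlib's `iteratedFDeriv`) of the differences of components on test
vectors `‖v‖, ‖w‖ ≤ 1` has norm `≤ ε` at every point of the annulus — to the data induced by
Schwarzschild(`M`) (`Kerr.smoothMetric M 0 r₁` on the chart `Kerr.region 0 r₁`, `r₁ < r₀`) on the
cylinder `{r = r₀}` along `schwCylMap r₀ 0`, the second fundamental form being taken w.r.t. the
FUTURE unit normal of `Kerr.timeOrientation` (sign convention (h) of `Hypersurface.lean`). The
frame `(ψ, ν)` on `Kerr.slice 0 1 = {1 < ‖y‖}` is pinned by the pointwise equation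
`ψ = schwCylMap r₀ 0` and by `IsFutureUnitNormal` (unique for a spacelike immersion); the `else 0`
branches are never reached when `1 ≤ ρ₁`. Same body as the crux line's predicate of the same
name. Li–Mei arXiv:2005.01249, Prop. 4.1 (their `‖·‖_{C^{k,α}(ḡ_{m₀})} < ε` on `H`). [folklore] -/
def NearSchwarzschildCylinder [Kerr.Facts] (M r₁ r₀ ρ₁ ρ₂ : ℝ) (k : ℕ) (ε : ℝ)
    (D : InitialDataSet (𝓡 3) E3) : Prop :=
  ∃ (hM : 0 ≤ M) (ψ : Kerr.slice 0 1 → Kerr.region 0 r₁) (ν : NormalField 𝓘(ℝ, E4) ψ),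
    (∀ y : Kerr.slice 0 1, (ψ y : E4) = schwCylMap r₀ 0 (y : E3)) ∧
    (Kerr.smoothMetric M 0 r₁).IsSpacelikeImmersion 𝓘(ℝ, E3) ψ ∧
    (Kerr.smoothMetric M 0 r₁).IsFutureUnitNormal 𝓘(ℝ, E3)
      ((Kerr.timeOrientation M 0 r₁ hM).ofLE le_top) ψ ν ∧
    ∀ (v w : E3), ‖v‖ ≤ 1 → ‖w‖ ≤ 1 → ∀ i ≤ k, ∀ y : E3, ρ₁ < ‖y‖ → ‖y‖ < ρ₂ →
      ‖iteratedFDeriv ℝ i (fun z : E3 ↦ D.h.inner z v w -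
          (if hz : z ∈ Kerr.slice 0 1 then
            pullbackBilin (I := 𝓘(ℝ, E4)) (I' := 𝓘(ℝ, E3)) ψ
              (Kerr.smoothMetric M 0 r₁).val ⟨z, hz⟩ v w
           else 0)) y‖ ≤ ε ∧
      ∀ [(Kerr.smoothMetric M 0 r₁).HasLeviCivita],
        ‖iteratedFDeriv ℝ i (fun z : E3 ↦ D.k z v w -
          (if hz : z ∈ Kerr.slice 0 1 then
            (Kerr.smoothMetric M 0 r₁).secondFundamentalForm 𝓘(ℝ, E3) ψ ν ⟨z, hz⟩ v w
           else 0)) y‖ ≤ ε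

/-- **Exact Kerr-cylinder data on `s ⊆ {1 < ‖y‖}`** (the CONCLUSION "Kerrian near `t₂`" of Li–Mei
Prop. 4.1, transported): `h = ψ^* g_{m,a}` and `k = K_ν(ψ)` at every point of `s`, for the standard
Kerr cylinder map `ψ = kerrCylMap r₀ a τ₀ R` into the chart `Kerr.region a r₁` (`r₁ < r₀`) of
Kerr(`m, a`) with its future unit normal `ν` — "the Kerr initial data induced on the slice
`{r = r₀}` inside the black hole with parameters `(m, a⃗)`" (arXiv:2005.01249, p. 22), read in the
tree's ingoing Kerr–Schild chart. The frame is pinned pointwise as in `NearSchwarzschildCylinder`.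
[folklore] -/
def IsKerrCylinderOn [Kerr.Facts] (m a r₀ τ₀ : ℝ) (R : E3 →ₗᵢ[ℝ] E3) (s : Set E3)
    (D : InitialDataSet (𝓡 3) E3) : Prop :=
  ∃ (r₁ : ℝ) (hm : 0 ≤ m) (ψ : Kerr.slice 0 1 → Kerr.region a r₁)
    (ν : NormalField 𝓘(ℝ, E4) ψ),
    r₁ < r₀ ∧
    (∀ y : Kerr.slice 0 1, (ψ y : E4) = kerrCylMap r₀ a τ₀ R (y : E3)) ∧
    (Kerr.smoothMetric m a r₁).IsSpacelikeImmersion 𝓘(ℝ, E3) ψ ∧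
    (Kerr.smoothMetric m a r₁).IsFutureUnitNormal 𝓘(ℝ, E3)
      ((Kerr.timeOrientation m a r₁ hm).ofLE le_top) ψ ν ∧
    (∀ y : Kerr.slice 0 1, (y : E3) ∈ s →
      D.h.inner (y : E3) =
        pullbackBilin (I := 𝓘(ℝ, E4)) (I' := 𝓘(ℝ, E3)) ψ (Kerr.smoothMetric m a r₁).val y) ∧
    (∀ [(Kerr.smoothMetric m a r₁).HasLeviCivita] (y : Kerr.slice 0 1), (y : E3) ∈ s →
      (D.k (y : E3)).toLinearMap₁₂ =
        (Kerr.smoothMetric m a r₁).secondFundamentalForm 𝓘(ℝ, E3) ψ ν y)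

/-! ### The named fact -/

/-- **Interior Kerr gluing on the cylinder `{r = r₀ < 2m}`** — J. Li, H. Mei, Comm. Math. Phys.
378 (2020) = arXiv:2005.01249, **Prop. 4.1** (§4, p. 22; = Thm. 2.2, §2.2, p. 8), as printed
(general spin), transported to the annulus `A = {ρ₁ < ‖y‖ < ρ₂}` of `E3` (module docstring). For
every geometry `0 < r₁ < r₀ < 2M`, `1 ≤ ρ₁ < ρ₂` there are an order `k`, a constant `C` and a
threshold `ε₀ > 0` such that for `0 < ε ≤ ε₀`: every smooth datum `D` on `E3` which solves the
vacuum constraints on `A` and is `ε`-close in sup-`C^k` on `A` to the Schwarzschild(`M`) cylinder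
`{r = r₀}` (`NearSchwarzschildCylinder`) can be deformed — inside `A`, by the Corvino–Schoen local
deformation plus the `4`-parameter Kerr family `(m, a⃗)` absorbing the cokernel
`span{∂_t, Ω₁, Ω₂, Ω₃}` (degree argument, p. 25) — to a smooth datum `D'` on `E3` which: has Kerr
parameters in the box `|m − M| + |a| ≤ C ε`, subextremal with `r₋(m,a) < r₀ < r₊(m,a)` (the
cylinder is inside the black hole); agrees with `D` on a ball `{‖y‖ < σ₁}`, `σ₁ > ρ₁` ("`= (ḡ, π̄)`
near `t₁`"); solves the vacuum constraints on `A`; and is EXACTLY the Kerr(`m, a`)-cylinder datum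
`{r = r₀}` in standard form `kerrCylMap r₀ a τ₀ R` on an outer sub-annulus `{σ₂ < ‖y‖ < ρ₂}`,
`σ₁ < σ₂ < ρ₂` ("Kerrian near `t₂`"). Smooth output for smooth input: the deformation step in the
exponentially weighted spaces of Chruściel–Delay 2003, Cor. 5.11 (module docstring). The output
closeness `‖(g̃, π̃) − (ḡ, π̄)‖_{C^{k,α}} < C ε` of the print is not recorded. Named fact (D-0014);
theorem in print. [cite: LiMei2020, Prop. 4.1] -/
def interiorKerrGluing : Prop :=
  ∀ [Kerr.Facts], ∀ (M r₁ r₀ ρ₁ ρ₂ : ℝ), 0 < r₁ → r₁ < r₀ → r₀ < 2 * M → 1 ≤ ρ₁ → ρ₁ < ρ₂ →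
    ∃ (k : ℕ) (C ε₀ : ℝ), 0 < ε₀ ∧ ∀ ε : ℝ, 0 < ε → ε ≤ ε₀ →
      ∀ D : InitialDataSet (𝓡 3) E3,
        IsVacuumOn {y | ρ₁ < ‖y‖ ∧ ‖y‖ < ρ₂} D →
        NearSchwarzschildCylinder M r₁ r₀ ρ₁ ρ₂ k ε D →
        ∃ (D' : InitialDataSet (𝓡 3) E3) (m a τ₀ σ₁ σ₂ : ℝ) (R : E3 →ₗᵢ[ℝ] E3),
          |m - M| + |a| ≤ C * ε ∧ |a| < m ∧ Kerr.rMinus m a < r₀ ∧ r₀ < Kerr.rPlus m a ∧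
          ρ₁ < σ₁ ∧ σ₁ < σ₂ ∧ σ₂ < ρ₂ ∧
          (∀ y : E3, ‖y‖ < σ₁ → D'.h.inner y = D.h.inner y ∧ D'.k y = D.k y) ∧
          IsVacuumOn {y | ρ₁ < ‖y‖ ∧ ‖y‖ < ρ₂} D' ∧
          IsKerrCylinderOn m a r₀ τ₀ R {y | σ₂ < ‖y‖ ∧ ‖y‖ < ρ₂} D'
  -- TODO(general form): data on an abstract cylinder `H ≅ (t₁, t₂) × S²` of finite regularity,
  -- closeness `< ε` and output closeness `< C ε` in `C^{k,α}(ḡ_{m₀})` (Li–Mei Prop. 4.1 verbatim).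

/-! ### Sanity: the pinned frames are inhabited -/

/-- `schwCylMap r₀ τ₀` lands on the cylinder `{r = r₀}` of the Schwarzschild chart (`a = 0`:
`Kerr.radius 0 = ‖x⃗‖`), for `0 < r₀` and `y ≠ 0`. Dafermos–Rodnianski arXiv:0811.0354, §5.1.
[folklore] -/
theorem radius_schwCylMap {r₀ : ℝ} (hr₀ : 0 < r₀) (τ₀ : ℝ) {y : E3} (hy : y ≠ 0) :
    Kerr.radius 0 (schwCylMap r₀ τ₀ y) = r₀ := by
  unfold schwCylMap
  rw [Kerr.radius_zero_left, E4.spatialNorm_ofTimeSpace, norm_smul, Real.norm_eq_abs,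
    abs_of_pos (div_pos hr₀ (norm_pos_iff.2 hy)), div_mul_cancel₀ _ (norm_ne_zero_iff.2 hy)]

/-- Points of `Kerr.slice 0 ρ` are nonzero vectors of `E3` (`Kerr.radius 0 (0, y) = ‖y‖ > 0`).
Dafermos–Rodnianski arXiv:0811.0354, §5.1. [folklore] -/
theorem ne_zero_of_mem_slice {ρ : ℝ} (y : Kerr.slice 0 ρ) : (y : E3) ≠ 0 := by
  have h := y.2
  rw [Kerr.mem_slice, Kerr.radius_zero_left, E4.spatialNorm_ofTimeSpace] at h
  exact norm_pos_iff.1 ((le_max_right ρ 0).trans_lt h)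

/-- The frame clause `∀ y, (ψ y : E4) = schwCylMap r₀ τ₀ y` of `NearSchwarzschildCylinder` /
`IsKerrCylinderOn` (at `a = 0`) is satisfiable for `r₁ < r₀`, `0 < r₀`: the model map sends
`Kerr.slice 0 1` into the chart `Kerr.region 0 r₁` (anti-vacuity of the pinned-map device).
[folklore] -/
theorem exists_schwCylFrame {r₁ r₀ : ℝ} (hr₀ : 0 < r₀) (hr₁ : r₁ < r₀) (τ₀ : ℝ) :
    ∃ ψ : Kerr.slice 0 1 → Kerr.region 0 r₁,
      ∀ y : Kerr.slice 0 1, (ψ y : E4) = schwCylMap r₀ τ₀ (y : E3) := by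
  refine ⟨fun y ↦ ⟨schwCylMap r₀ τ₀ (y : E3), ?_⟩, fun y ↦ rfl⟩
  rw [Kerr.mem_region, radius_schwCylMap hr₀ τ₀ (ne_zero_of_mem_slice y)]
  exact max_lt hr₁ hr₀

/-- On unit vectors the ellipsoid parametrisation lands on `{Kerr.radius a = r₀}` (`0 ≤ r₀`): with
`ρ² = ‖x⃗‖² = r₀² + a² − a² n₂²` and `z = r₀ n₂` the radicand of `Kerr.radius` collapses,
`(ρ² − a²)² + 4a²z² = (r₀² + a² n₂²)²`, to `r² = r₀²`. Visser arXiv:0706.0622, (35).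
[cite: arXiv07060622, (35)] -/
theorem radius_ellipsoidPt {r₀ : ℝ} (hr₀ : 0 ≤ r₀) (a t : ℝ) {n : E3} (hn : ‖n‖ = 1) :
    Kerr.radius a (E4.ofTimeSpace t (ellipsoidPt r₀ a n)) = r₀ := by
  have hn2 : n 0 ^ 2 + n 1 ^ 2 + n 2 ^ 2 = 1 := by
    have h := EuclideanSpace.real_norm_sq_eq n
    rw [hn, one_pow, Fin.sum_univ_three] at h
    linarith
  have hsq : Real.sqrt (r₀ ^ 2 + a ^ 2) ^ 2 = r₀ ^ 2 + a ^ 2 := Real.sq_sqrt (by positivity)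
  have hρ : E4.spatialNorm (E4.ofTimeSpace t (ellipsoidPt r₀ a n)) ^ 2 =
      r₀ ^ 2 + a ^ 2 - a ^ 2 * n 2 ^ 2 := by
    rw [E4.spatialNorm_ofTimeSpace, EuclideanSpace.real_norm_sq_eq, Fin.sum_univ_three]
    simp only [ellipsoidPt, PiLp.toLp_apply, Matrix.cons_val_zero, Matrix.cons_val_one,
      Matrix.cons_val]
    nlinarith [hsq, hn2]
  have hz : E4.ofTimeSpace t (ellipsoidPt r₀ a n) 3 = r₀ * n 2 := by
    rw [show (3 : Fin 4) = Fin.succ 2 from rfl, E4.ofTimeSpace_apply_succ]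
    simp [ellipsoidPt]
  have hdisc : (E4.spatialNorm (E4.ofTimeSpace t (ellipsoidPt r₀ a n)) ^ 2 - a ^ 2) ^ 2 +
      4 * a ^ 2 * E4.ofTimeSpace t (ellipsoidPt r₀ a n) 3 ^ 2 = (r₀ ^ 2 + a ^ 2 * n 2 ^ 2) ^ 2 := by
    rw [hρ, hz]; ring
  unfold Kerr.radius
  rw [hdisc, Real.sqrt_sq (by positivity), hρ,
    show (r₀ ^ 2 + a ^ 2 - a ^ 2 * n 2 ^ 2 - a ^ 2 + (r₀ ^ 2 + a ^ 2 * n 2 ^ 2)) / 2 = r₀ ^ 2 by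
      ring,
    Real.sqrt_sq hr₀]

/-- At zero spin and trivial rotation the Kerr cylinder map IS the Schwarzschild cylinder map
(off the origin, `0 ≤ r₀`): `ellipsoidPt r₀ 0 n = r₀ n` and `r₀ (y/‖y‖) = (r₀/‖y‖) y`. This is the
reduction `IsKerrCylinderOn m 0 r₀ τ₀ 1 = ` "exact Schwarzschild-cylinder data" used by consumers at
`a = 0`. [folklore] -/
theorem kerrCylMap_zero_id {r₀ : ℝ} (hr₀ : 0 ≤ r₀) (τ₀ : ℝ) {y : E3} (hy : y ≠ 0) :
    kerrCylMap r₀ 0 τ₀ LinearIsometry.id y = schwCylMap r₀ τ₀ y := by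
  have hn : ‖y‖ ≠ 0 := norm_ne_zero_iff.2 hy
  have hell : ellipsoidPt r₀ 0 (‖y‖⁻¹ • y) = (r₀ / ‖y‖) • y := by
    have hs : Real.sqrt (r₀ ^ 2 + 0 ^ 2) = r₀ := by
      rw [show r₀ ^ 2 + (0 : ℝ) ^ 2 = r₀ ^ 2 by ring, Real.sqrt_sq hr₀]
    ext i
    simp only [ellipsoidPt, hs, PiLp.toLp_apply, PiLp.smul_apply, smul_eq_mul]
    fin_cases i <;> simp [div_eq_mul_inv] <;> ring
  simp only [kerrCylMap, schwCylMap, LinearIsometry.coe_id, id_eq, hell]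

/-- The frame clause of `IsKerrCylinderOn` is satisfiable for `r₁ < r₀`, `0 < r₀`, any spin `a`,
shift `τ₀` and linear isometry `R`: `kerrCylMap r₀ a τ₀ R` sends `Kerr.slice 0 1` into the chart
`Kerr.region a r₁` (anti-vacuity). Visser arXiv:0706.0622, (35). [folklore] -/
theorem exists_kerrCylFrame {r₁ r₀ : ℝ} (hr₀ : 0 < r₀) (hr₁ : r₁ < r₀) (a τ₀ : ℝ)
    (R : E3 →ₗᵢ[ℝ] E3) :
    ∃ ψ : Kerr.slice 0 1 → Kerr.region a r₁,
      ∀ y : Kerr.slice 0 1, (ψ y : E4) = kerrCylMap r₀ a τ₀ R (y : E3) := by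
  refine ⟨fun y ↦ ⟨kerrCylMap r₀ a τ₀ R (y : E3), ?_⟩, fun y ↦ rfl⟩
  have hy : (y : E3) ≠ 0 := ne_zero_of_mem_slice y
  have hn : ‖R (‖(y : E3)‖⁻¹ • (y : E3))‖ = 1 := by
    rw [LinearIsometry.norm_map, norm_smul, norm_inv, norm_norm,
      inv_mul_cancel₀ (norm_ne_zero_iff.2 hy)]
  rw [Kerr.mem_region, kerrCylMap, radius_ellipsoidPt hr₀.le a _ hn]
  exact max_lt hr₁ hr₀

end LiMei

end Literature.Geometry.Lorentzian

end
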